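import Mathlib
import Summits.ValiantsHypothesis.ValiantsHypothesis.Theorems.NewtonUnitEquationsDissociatedUniformQuasiPoly

/-!
# Cell decomposition of the chart shadows (stub E1 `CellDecomposition` of crux `DissociatedUniform`)

Line `greedy-basis-shadow` of crux stmt-ValiantsHypothesis-5905 `NewtonUnitEquations.DissociatedUniform`.
By the chart decomposition `QuasiPoly.ncard_cshadow_le_charts`, the frame shadow `QuasiPoly.fshadow A f` is
controlled by the two chart shadows along the pencils of heights `a ↦ ε·X(a) + λ·Y(a)` (`ε = ±1`, `λ ∈ ℝ`).
The parameter line splits at a finite set (`exists_crit`) containing the roots of the affine "pair-of-pairs" letter comparisons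
`ε (X l₁ - X l₂ - X l₃ + X l₄) + λ (Y l₁ - Y l₂ - Y l₃ + Y l₄)` (`l₁, l₂ ∈ A j`, `l₃, l₄ ∈ A j'`; at most `(m t²)²` of them)
into at most `(m t²)² + 1` CELLS (non-critical parameters with the same number of critical values below them), and on a
cell every such comparison has constant strict signs (`signs_of_sameCell`).  Hence a uniform bound `Q` on the greedy
words met at the injective parameters of one cell gives `≤ ((m t²)² + 1) Q + (m t²)² k` greedy words along a pencil
(a single parameter contributes at most `k`, `QuasiPoly.ncard_gE_le`), and
`|fshadow A f| ≤ 2 (((m k²)² + 1) Q + (m k²)² k) + 2k + 1`.  Pure bookkeeping. [folklore]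
-/

noncomputable section

open scoped BigOperators

-- Sub = Summit single-conjunct layout: the duplicated namespace component is mandated by the tree.
set_option linter.dupNamespace false

namespace Summit.ValiantsHypothesis.ValiantsHypothesis.Theorems.NewtonUnitEquationsDissociatedUniform

namespace CellDecomposition

variable {α L : Type} {k m : ℕ}

/-- Two reals with positive product have the same strict signs. -/
theorem iffs_of_mul_pos {x y : ℝ} (h : 0 < x * y) : (x < 0 ↔ y < 0) ∧ (0 < x ↔ 0 < y) := by
  rcases pos_and_pos_or_neg_and_neg_of_mul_pos h with ⟨hx, hy⟩ | ⟨hx, hy⟩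
  · refine ⟨⟨fun _ => ?_, fun _ => ?_⟩, ⟨fun _ => hy, fun _ => hx⟩⟩ <;> linarith
  · refine ⟨⟨fun _ => hy, fun _ => hx⟩, ⟨fun _ => ?_, fun _ => ?_⟩⟩ <;> linarith

/-- **Cells.**  Off a finite set `C` of parameters containing the root of the affine function `μ ↦ a + μ s`
(if `s ≠ 0`), two parameters with the same number of elements of `C` below them give `a + μ s` the same strict signs:
otherwise the root would lie strictly between them and the two counts would differ. -/
theorem signs_of_sameCell (C : Finset ℝ) (a s lam lam' : ℝ) (hroot : s ≠ 0 → -a / s ∈ C)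
    (hlam : lam ∉ C) (hlam' : lam' ∉ C) (hidx : (C.filter (· < lam)).card = (C.filter (· < lam')).card) :
    (a + lam * s < 0 ↔ a + lam' * s < 0) ∧ (0 < a + lam * s ↔ 0 < a + lam' * s) := by
  rcases eq_or_ne s 0 with rfl | hs
  · simp
  obtain ⟨r, hr⟩ : ∃ r : ℝ, r = -a / s := ⟨_, rfl⟩
  have hrC : r ∈ C := by
    rw [hr]
    exact hroot hs
  have hrs : r * s = -a := by
    rw [hr]
    exact div_mul_cancel₀ (-a) hs
  -- one-sided transport of `μ < r` between two parameters of the same cell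
  have key : ∀ μ μ' : ℝ, μ' ∉ C → (C.filter (· < μ)).card = (C.filter (· < μ')).card → μ < r → μ' < r := by
    intro μ μ' hμ' hcardeq hμ
    by_contra hge
    rw [not_lt] at hge
    have hlt : r < μ' := lt_of_le_of_ne hge fun h => hμ' (by rw [← h]; exact hrC)
    have hsubset : C.filter (· < μ) ⊆ C.filter (· < μ') := by
      intro c hc
      rw [Finset.mem_filter] at hc ⊢
      exact ⟨hc.1, hc.2.trans (hμ.trans hlt)⟩
    have hssub : C.filter (· < μ) ⊂ C.filter (· < μ') :=
      (Finset.ssubset_iff_of_subset hsubset).mpr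
        ⟨r, Finset.mem_filter.mpr ⟨hrC, hlt⟩, fun h => lt_asymm (Finset.mem_filter.mp h).2 hμ⟩
    exact absurd hcardeq (Finset.card_lt_card hssub).ne
  have hside : 0 < (lam - r) * (lam' - r) := by
    rcases lt_or_gt_of_ne (show lam ≠ r from fun h => hlam (by rw [h]; exact hrC)) with h | h
    · exact mul_pos_of_neg_of_neg (sub_neg.mpr h) (sub_neg.mpr (key lam lam' hlam' hidx h))
    · have h' : r < lam' := by
        refine lt_of_le_of_ne (not_lt.mp fun h'' => (lt_asymm h) (key lam' lam hlam hidx.symm h'')) ?_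
        exact fun h'' => hlam' (by rw [← h'']; exact hrC)
      exact mul_pos (sub_pos.mpr h) (sub_pos.mpr h')
  have hprod : 0 < (a + lam * s) * (a + lam' * s) := by
    have heq : (a + lam * s) * (a + lam' * s) = s * s * ((lam - r) * (lam' - r)) := by
      linear_combination (a - r * s + s * (lam + lam')) * hrs
    rw [heq]
    exact mul_pos (mul_self_pos.mpr hs) hside
  exact iffs_of_mul_pos hprod

/-- The critical parameters of a pencil `ε X + λ Y` on the frame `A`: at most `(m t²)²` reals containing the roots
in `λ` of all non-degenerate comparisons `ε (X l₁ - X l₂ - X l₃ + X l₄) + λ (Y l₁ - Y l₂ - Y l₃ + Y l₄)`,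
`l₁, l₂ ∈ A j`, `l₃, l₄ ∈ A j'` (the image of all such quadruples, junk values at the degenerate ones). -/
theorem exists_crit (A : Fin m → Finset L) (X Y : L → ℝ) (ε : ℝ) (t : ℕ) (hcard : ∀ j, (A j).card ≤ t) :
    ∃ C : Finset ℝ, C.card ≤ (m * t ^ 2) ^ 2 ∧
      ∀ (j j' : Fin m), ∀ l₁ ∈ A j, ∀ l₂ ∈ A j, ∀ l₃ ∈ A j', ∀ l₄ ∈ A j',
        -(ε * (X l₁ - X l₂ - X l₃ + X l₄)) / (Y l₁ - Y l₂ - Y l₃ + Y l₄) ∈ C := by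
  refine ⟨Finset.univ.biUnion fun j : Fin m => Finset.univ.biUnion fun j' : Fin m =>
    ((A j ×ˢ A j) ×ˢ (A j' ×ˢ A j')).image fun q : (L × L) × (L × L) =>
      -(ε * (X q.1.1 - X q.1.2 - X q.2.1 + X q.2.2)) / (Y q.1.1 - Y q.1.2 - Y q.2.1 + Y q.2.2), ?_, ?_⟩
  · have hjj : ∀ (j j' : Fin m) (g : (L × L) × (L × L) → ℝ),
        (((A j ×ˢ A j) ×ˢ (A j' ×ˢ A j')).image g).card ≤ t * t * (t * t) := by
      intro j j' g
      refine Finset.card_image_le.trans ?_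
      rw [Finset.card_product, Finset.card_product, Finset.card_product]
      exact Nat.mul_le_mul (Nat.mul_le_mul (hcard j) (hcard j)) (Nat.mul_le_mul (hcard j') (hcard j'))
    calc _ ≤ ∑ _j : Fin m, ∑ _j' : Fin m, t * t * (t * t) := by
          refine Finset.card_biUnion_le.trans (Finset.sum_le_sum fun j _ => ?_)
          exact Finset.card_biUnion_le.trans (Finset.sum_le_sum fun j' _ => hjj j j' _)
      _ = (m * t ^ 2) ^ 2 := by
          simp only [Finset.sum_const, Finset.card_univ, Fintype.card_fin, smul_eq_mul]
          ring
  · intro j j' l₁ h₁ l₂ h₂ l₃ h₃ l₄ h₄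
    refine Finset.mem_biUnion.mpr ⟨j, Finset.mem_univ _, Finset.mem_biUnion.mpr ⟨j', Finset.mem_univ _, ?_⟩⟩
    exact Finset.mem_image.mpr ⟨((l₁, l₂), (l₃, l₄)),
      Finset.mem_product.mpr ⟨Finset.mem_product.mpr ⟨h₁, h₂⟩, Finset.mem_product.mpr ⟨h₃, h₄⟩⟩, rfl⟩

/-- At a single parameter at most `k` greedy words are counted (none unless the height is injective). -/
theorem ncard_inj_gE_le (E : Finset α) (x : α → Fin k → ℂ) (h : α → ℝ) :
    {a : α | Set.InjOn h E ∧ a ∈ QuasiPoly.gE E x h}.ncard ≤ k := by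
  by_cases hinj : Set.InjOn h E
  · have hset : {a : α | Set.InjOn h E ∧ a ∈ QuasiPoly.gE E x h} = QuasiPoly.gE E x h :=
      Set.ext fun _ => ⟨fun ha => ha.2, fun ha => ⟨hinj, ha⟩⟩
    rw [hset]
    exact QuasiPoly.ncard_gE_le E x h hinj
  · have hset : {a : α | Set.InjOn h E ∧ a ∈ QuasiPoly.gE E x h} = ∅ :=
      Set.subset_empty_iff.mp fun _ ha => (hinj ha.1).elim
    rw [hset, Set.ncard_empty]
    exact Nat.zero_le _

/-- **Cell decomposition of a pencil, abstract form.**  `H` is any pencil of heights, `C` any finite set of parameters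
containing the roots of the non-degenerate comparisons; if the greedy words met at the injective parameters of every
set of parameters with constant comparison signs number at most `Q`, then the pencil meets at most
`(C.card + 1) Q + C.card · k` greedy words at injective parameters. -/
theorem ncard_pencil_le_of_roots (E : Finset α) (x : α → Fin k → ℂ) (H : ℝ → α → ℝ) (A : Fin m → Finset L)
    (X Y : L → ℝ) (ε : ℝ) (Q : ℕ) (C : Finset ℝ)
    (hroot : ∀ (j j' : Fin m), ∀ l₁ ∈ A j, ∀ l₂ ∈ A j, ∀ l₃ ∈ A j', ∀ l₄ ∈ A j',
      -(ε * (X l₁ - X l₂ - X l₃ + X l₄)) / (Y l₁ - Y l₂ - Y l₃ + Y l₄) ∈ C)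
    (hQ : ∀ Λ : Set ℝ,
      (∀ (j j' : Fin m), ∀ l₁ ∈ A j, ∀ l₂ ∈ A j, ∀ l₃ ∈ A j', ∀ l₄ ∈ A j', ∀ lam ∈ Λ, ∀ lam' ∈ Λ,
        ((ε * (X l₁ - X l₂ - X l₃ + X l₄) + lam * (Y l₁ - Y l₂ - Y l₃ + Y l₄) < 0 ↔
            ε * (X l₁ - X l₂ - X l₃ + X l₄) + lam' * (Y l₁ - Y l₂ - Y l₃ + Y l₄) < 0) ∧
          (0 < ε * (X l₁ - X l₂ - X l₃ + X l₄) + lam * (Y l₁ - Y l₂ - Y l₃ + Y l₄) ↔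
            0 < ε * (X l₁ - X l₂ - X l₃ + X l₄) + lam' * (Y l₁ - Y l₂ - Y l₃ + Y l₄)))) →
      {a : α | ∃ lam ∈ Λ, Set.InjOn (H lam) E ∧ a ∈ QuasiPoly.gE E x (H lam)}.ncard ≤ Q) :
    {a : α | ∃ lam : ℝ, Set.InjOn (H lam) E ∧ a ∈ QuasiPoly.gE E x (H lam)}.ncard ≤
      (C.card + 1) * Q + C.card * k := by
  -- cover by the `C.card + 1` cells and the `C.card` critical fibres
  have hcover : {a : α | ∃ lam : ℝ, Set.InjOn (H lam) E ∧ a ∈ QuasiPoly.gE E x (H lam)} ⊆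
      (⋃ i ∈ Finset.range (C.card + 1), {a : α | ∃ lam ∈ {μ : ℝ | μ ∉ C ∧ (C.filter (· < μ)).card = i},
        Set.InjOn (H lam) E ∧ a ∈ QuasiPoly.gE E x (H lam)}) ∪
      ⋃ c ∈ C, {a : α | Set.InjOn (H c) E ∧ a ∈ QuasiPoly.gE E x (H c)} := by
    rintro a ⟨lam, hinj, ha⟩
    by_cases hlam : lam ∈ C
    · exact Set.mem_union_right _ (Set.mem_iUnion₂.mpr ⟨lam, hlam, hinj, ha⟩)
    · refine Set.mem_union_left _ (Set.mem_iUnion₂.mpr ⟨(C.filter (· < lam)).card, ?_, lam, ⟨hlam, rfl⟩, hinj, ha⟩)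
      exact Finset.mem_range.mpr (Nat.lt_succ_of_le (Finset.card_filter_le _ _))
  have hfin : ((⋃ i ∈ Finset.range (C.card + 1), {a : α | ∃ lam ∈ {μ : ℝ | μ ∉ C ∧ (C.filter (· < μ)).card = i},
        Set.InjOn (H lam) E ∧ a ∈ QuasiPoly.gE E x (H lam)}) ∪
      ⋃ c ∈ C, {a : α | Set.InjOn (H c) E ∧ a ∈ QuasiPoly.gE E x (H c)}).Finite :=
    E.finite_toSet.subset (Set.union_subset
      (Set.iUnion₂_subset fun _ _ _ ha => ha.elim fun _ h => h.2.2.1)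
      (Set.iUnion₂_subset fun _ _ _ ha => ha.2.1))
  calc {a : α | ∃ lam : ℝ, Set.InjOn (H lam) E ∧ a ∈ QuasiPoly.gE E x (H lam)}.ncard
      ≤ _ := Set.ncard_le_ncard hcover hfin
    _ ≤ (⋃ i ∈ Finset.range (C.card + 1), {a : α | ∃ lam ∈ {μ : ℝ | μ ∉ C ∧ (C.filter (· < μ)).card = i},
          Set.InjOn (H lam) E ∧ a ∈ QuasiPoly.gE E x (H lam)}).ncard +
        (⋃ c ∈ C, {a : α | Set.InjOn (H c) E ∧ a ∈ QuasiPoly.gE E x (H c)}).ncard := Set.ncard_union_le _ _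
    _ ≤ ∑ i ∈ Finset.range (C.card + 1), {a : α | ∃ lam ∈ {μ : ℝ | μ ∉ C ∧ (C.filter (· < μ)).card = i},
          Set.InjOn (H lam) E ∧ a ∈ QuasiPoly.gE E x (H lam)}.ncard +
        ∑ c ∈ C, {a : α | Set.InjOn (H c) E ∧ a ∈ QuasiPoly.gE E x (H c)}.ncard :=
        add_le_add (Finset.set_ncard_biUnion_le _ _) (Finset.set_ncard_biUnion_le _ _)
    _ ≤ ∑ _i ∈ Finset.range (C.card + 1), Q + ∑ _c ∈ C, k := by
        refine add_le_add (Finset.sum_le_sum fun i _ => hQ _ ?_)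
          (Finset.sum_le_sum fun c _ => ncard_inj_gE_le E x (H c))
        intro j j' l₁ h₁ l₂ h₂ l₃ h₃ l₄ h₄ lam hlam lam' hlam'
        exact signs_of_sameCell C _ _ lam lam' (fun _ => hroot j j' l₁ h₁ l₂ h₂ l₃ h₃ l₄ h₄) hlam.1 hlam'.1
          (hlam.2.trans hlam'.2.symm)
    _ = (C.card + 1) * Q + C.card * k := by
        simp only [Finset.sum_const, Finset.card_range, smul_eq_mul]

/-- **Cell decomposition of a pencil.**  With `≤ t` letters per coordinate: at most `((m t²)² + 1) Q + (m t²)² k`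
greedy words at injective parameters along the pencil. -/
theorem ncard_pencil_le (E : Finset α) (x : α → Fin k → ℂ) (H : ℝ → α → ℝ) (A : Fin m → Finset L)
    (X Y : L → ℝ) (ε : ℝ) (Q t : ℕ) (hcard : ∀ j, (A j).card ≤ t)
    (hQ : ∀ Λ : Set ℝ,
      (∀ (j j' : Fin m), ∀ l₁ ∈ A j, ∀ l₂ ∈ A j, ∀ l₃ ∈ A j', ∀ l₄ ∈ A j', ∀ lam ∈ Λ, ∀ lam' ∈ Λ,
        ((ε * (X l₁ - X l₂ - X l₃ + X l₄) + lam * (Y l₁ - Y l₂ - Y l₃ + Y l₄) < 0 ↔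
            ε * (X l₁ - X l₂ - X l₃ + X l₄) + lam' * (Y l₁ - Y l₂ - Y l₃ + Y l₄) < 0) ∧
          (0 < ε * (X l₁ - X l₂ - X l₃ + X l₄) + lam * (Y l₁ - Y l₂ - Y l₃ + Y l₄) ↔
            0 < ε * (X l₁ - X l₂ - X l₃ + X l₄) + lam' * (Y l₁ - Y l₂ - Y l₃ + Y l₄)))) →
      {a : α | ∃ lam ∈ Λ, Set.InjOn (H lam) E ∧ a ∈ QuasiPoly.gE E x (H lam)}.ncard ≤ Q) :
    {a : α | ∃ lam : ℝ, Set.InjOn (H lam) E ∧ a ∈ QuasiPoly.gE E x (H lam)}.ncard ≤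
      ((m * t ^ 2) ^ 2 + 1) * Q + (m * t ^ 2) ^ 2 * k := by
  obtain ⟨C, hc, hroot⟩ := exists_crit A X Y ε t hcard
  have h := ncard_pencil_le_of_roots E x H A X Y ε Q C hroot hQ
  calc _ ≤ _ := h
    _ ≤ ((m * t ^ 2) ^ 2 + 1) * Q + (m * t ^ 2) ^ 2 * k := by gcongr

/-- A chart shadow written as a pencil set. -/
theorem chartShadow_subset_pencil (E : Finset α) (x : α → Fin k → ℂ) (u v : α → ℝ) (H : ℝ → α → ℝ)
    (hH : ∀ lam : ℝ, (fun e => u e + lam * v e) = H lam) :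
    QuasiPoly.chartShadow E x u v ⊆ {a : α | ∃ lam : ℝ, Set.InjOn (H lam) E ∧ a ∈ QuasiPoly.gE E x (H lam)} := by
  rintro a ⟨lam, hinj, ha⟩
  rw [hH lam] at hinj ha
  exact ⟨lam, hinj, ha⟩

/-- Pencil sets lie in `E`, hence are finite. -/
theorem pencil_finite (E : Finset α) (x : α → Fin k → ℂ) (H : ℝ → α → ℝ) :
    {a : α | ∃ lam : ℝ, Set.InjOn (H lam) E ∧ a ∈ QuasiPoly.gE E x (H lam)}.Finite :=
  E.finite_toSet.subset fun _ ha => ha.elim fun _ h => h.2.1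

end CellDecomposition

/-- Registered stub E1 = `CellDecomposition` (TRUE; chart decomposition + splitting each chart at the roots of the
pair-of-pairs letter comparisons): a uniform bound `Q` on the cell shadows of both charts bounds the frame shadow by
`2(((m·k²)² + 1)·Q + (m·k²)²·k) + 2k + 1`. -/
theorem stub_cellDecomposition :
    ∀ (k m Q : ℕ) (A : Fin m → Finset (Fin 2 →₀ ℕ)) (f : Fin k → Fin m → MvPolynomial (Fin 2) ℂ),
      (∀ j, (A j).card ≤ k) →
      (∀ (ε : ℝ) (Λ : Set ℝ), (ε = 1 ∨ ε = -1) →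
        (∀ (j j' : Fin m), ∀ l₁ ∈ A j, ∀ l₂ ∈ A j, ∀ l₃ ∈ A j', ∀ l₄ ∈ A j', ∀ lam ∈ Λ, ∀ lam' ∈ Λ,
          ((ε * ((((l₁ 0 : ℕ) : ℝ)) - (((l₂ 0 : ℕ) : ℝ)) - (((l₃ 0 : ℕ) : ℝ)) + (((l₄ 0 : ℕ) : ℝ))) +
              lam * ((((l₁ 1 : ℕ) : ℝ)) - (((l₂ 1 : ℕ) : ℝ)) - (((l₃ 1 : ℕ) : ℝ)) + (((l₄ 1 : ℕ) : ℝ))) < 0 ↔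
            ε * ((((l₁ 0 : ℕ) : ℝ)) - (((l₂ 0 : ℕ) : ℝ)) - (((l₃ 0 : ℕ) : ℝ)) + (((l₄ 0 : ℕ) : ℝ))) +
              lam' * ((((l₁ 1 : ℕ) : ℝ)) - (((l₂ 1 : ℕ) : ℝ)) - (((l₃ 1 : ℕ) : ℝ)) + (((l₄ 1 : ℕ) : ℝ))) < 0) ∧
          (0 < ε * ((((l₁ 0 : ℕ) : ℝ)) - (((l₂ 0 : ℕ) : ℝ)) - (((l₃ 0 : ℕ) : ℝ)) + (((l₄ 0 : ℕ) : ℝ))) +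
              lam * ((((l₁ 1 : ℕ) : ℝ)) - (((l₂ 1 : ℕ) : ℝ)) - (((l₃ 1 : ℕ) : ℝ)) + (((l₄ 1 : ℕ) : ℝ))) ↔
            0 < ε * ((((l₁ 0 : ℕ) : ℝ)) - (((l₂ 0 : ℕ) : ℝ)) - (((l₃ 0 : ℕ) : ℝ)) + (((l₄ 0 : ℕ) : ℝ))) +
              lam' * ((((l₁ 1 : ℕ) : ℝ)) - (((l₂ 1 : ℕ) : ℝ)) - (((l₃ 1 : ℕ) : ℝ)) + (((l₄ 1 : ℕ) : ℝ)))))) →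
        {a : Fin m → (Fin 2 →₀ ℕ) | ∃ lam ∈ Λ,
            Set.InjOn (fun a : Fin m → (Fin 2 →₀ ℕ) => ε * QuasiPoly.Xf a + lam * QuasiPoly.Yf a) (Fintype.piFinset A) ∧
            a ∈ QuasiPoly.gE (Fintype.piFinset A) (QuasiPoly.col f)
              (fun a : Fin m → (Fin 2 →₀ ℕ) => ε * QuasiPoly.Xf a + lam * QuasiPoly.Yf a)}.ncard ≤ Q) →
      (QuasiPoly.fshadow A f).ncard ≤ 2 * (((m * k ^ 2) ^ 2 + 1) * Q + (m * k ^ 2) ^ 2 * k) + k + k + 1 := by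
  intro k m Q A f hcard hQ
  -- each chart is a pencil of the hypothesis' shape (`u = ε • Xf`)
  have hchart : ∀ ε : ℝ, (ε = 1 ∨ ε = -1) → ∀ u : (Fin m → (Fin 2 →₀ ℕ)) → ℝ,
      (∀ a, u a = ε * QuasiPoly.Xf a) →
      (QuasiPoly.chartShadow (Fintype.piFinset A) (QuasiPoly.col f) u QuasiPoly.Yf).ncard ≤
        ((m * k ^ 2) ^ 2 + 1) * Q + (m * k ^ 2) ^ 2 * k := by
    intro ε hε u hu
    have hH : ∀ lam : ℝ, (fun e : Fin m → (Fin 2 →₀ ℕ) => u e + lam * QuasiPoly.Yf e) =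
        fun a : Fin m → (Fin 2 →₀ ℕ) => ε * QuasiPoly.Xf a + lam * QuasiPoly.Yf a := by
      intro lam
      funext a
      rw [hu]
    exact le_trans
      (Set.ncard_le_ncard
        (CellDecomposition.chartShadow_subset_pencil (Fintype.piFinset A) (QuasiPoly.col f) u QuasiPoly.Yf
          (fun (lam : ℝ) (a : Fin m → (Fin 2 →₀ ℕ)) => ε * QuasiPoly.Xf a + lam * QuasiPoly.Yf a) hH)
        (CellDecomposition.pencil_finite _ _ _))
      (CellDecomposition.ncard_pencil_le (Fintype.piFinset A) (QuasiPoly.col f)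
        (fun (lam : ℝ) (a : Fin m → (Fin 2 →₀ ℕ)) => ε * QuasiPoly.Xf a + lam * QuasiPoly.Yf a) A
        (fun l : Fin 2 →₀ ℕ => ((l 0 : ℕ) : ℝ)) (fun l : Fin 2 →₀ ℕ => ((l 1 : ℕ) : ℝ)) ε Q k hcard
        (fun Λ hc => hQ ε Λ hε hc))
  have hpos := hchart 1 (Or.inl rfl) QuasiPoly.Xf fun a => (one_mul _).symm
  have hneg := hchart (-1) (Or.inr rfl) (fun e => -QuasiPoly.Xf e) fun a => (neg_one_mul _).symm
  have hdec := QuasiPoly.ncard_cshadow_le_charts (Fintype.piFinset A) (QuasiPoly.col f) QuasiPoly.Xf QuasiPoly.Yf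
  calc (QuasiPoly.fshadow A f).ncard
      = (QuasiPoly.cshadow (Fintype.piFinset A) (QuasiPoly.col f) QuasiPoly.Xf QuasiPoly.Yf).ncard := rfl
    _ ≤ _ := hdec
    _ ≤ (((m * k ^ 2) ^ 2 + 1) * Q + (m * k ^ 2) ^ 2 * k) + (((m * k ^ 2) ^ 2 + 1) * Q + (m * k ^ 2) ^ 2 * k) +
          k + k + 1 := by gcongr
    _ = 2 * (((m * k ^ 2) ^ 2 + 1) * Q + (m * k ^ 2) ^ 2 * k) + k + k + 1 := by ring

end Summit.ValiantsHypothesis.ValiantsHypothesis.Theorems.NewtonUnitEquationsDissociatedUniform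

end
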